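import Summits.QuantumFields.QCD.Theses.SpectralDefectExtinction
import Literature.MathematicalPhysics.QuantumFieldTheory.QCDPhaseQuenched
import Literature.MathematicalPhysics.QuantumFieldTheory.SpectralDefectDensity
import Literature.Barriers.QuantumFields.WilsonDeterminantMassSplitting

/-!
# Bridge lemma F toward stub `coareaWegner` of line `Sketch` (skeleton "ResolventCell", gen 2) for
crux `SpectralDefectExtinction.WegnerEstimate` (item stmt-QuantumFields-8966):
the SLICE LEMMA — product Haar is an average over one-link circles

The 1-D route of the paper proof (Lines/Sketch.md §gen 2) reduces every product-Haar expectation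
`E_V F(V)` over the cell configurations `V : ι → G` (here `ι = Edge 4 L`, `G = SU(3)`,
`μ = Measure.pi fun _ => haarProbability G`) to expectations along the one-parameter circles
`t ↦ V[e ↦ V(e) · c(t)]` of ONE link `e`:

* `coareaWegner_lintegral_pi_update_mul` — for every `g : G` and EVERY `F ≥ 0` (no measurability),
  `∫⁻ F(V[e ↦ V(e) g]) dμ = ∫⁻ F dμ`: right multiplication by the link field `1[e ↦ g]` is a
  measurable equivalence preserving the product of the right-invariant Haar probability measures
  (compact groups are unimodular; Mathlib `Measure.pi.isMulRightInvariant`,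
  `lintegral_mul_right_eq_self`);
* `coareaWegner_lintegral_pi_eq_average` — hence, for measurable `F` and any measurable curve
  `c : ℝ → G` and `T > 0`, `∫⁻ F dμ = T⁻¹ ∫⁻_V ∫⁻_{t ∈ (0,T]} F(V[e ↦ V(e) c(t)]) dt dμ`
  (average the constant over `t`, then Tonelli `lintegral_lintegral_swap`);
* `coareaWegner_lintegral_pi_eq_circleAverage` — the case `T = 2π` used along the closed `SU(3)`
  circles `cᵢ(t) = exp(t Xᵢ)` of bridge lemma C (`coareaWegner_su3Circles`).

No group law for `c` is needed for the slice identity itself (it is used later, to identify the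
circle through `V[e ↦ V(e)c(t)]` with the reparametrised circle through `V`).
-/

noncomputable section

namespace Summit.QuantumFields.QCD.Cruxes.WegnerEstimate.ResolventCell

open MeasureTheory
open scoped Matrix BigOperators ENNReal
open Literature.MathematicalPhysics.QuantumLattice Literature.MathematicalPhysics.QuantumFieldTheory
  Literature.Probability.LatticeModels
open Matrix
open scoped ComplexOrder

section Slice

variable {G : Type*} [Group G] [TopologicalSpace G] [IsTopologicalGroup G] [CompactSpace G]
  [MeasurableSpace G] [BorelSpace G] {ι : Type*} [Fintype ι] [DecidableEq ι]

omit [TopologicalSpace G] [IsTopologicalGroup G] [CompactSpace G] [MeasurableSpace G]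
  [BorelSpace G] [Fintype ι] in
/-- Updating one coordinate by right multiplication is right multiplication in the Pi group by the
link field `1[e ↦ g]`. -/
theorem coareaWegner_update_mul_eq (V : ι → G) (e : ι) (g : G) :
    Function.update V e (V e * g) = V * Function.update (1 : ι → G) e g := by
  ext i
  by_cases h : i = e
  · subst h
    simp
  · simp [h]

/-- **Slice lemma, one group element (no measurability needed).**  For the product of the Haar
probability measures over the links, right-multiplying ONE link by a fixed group element does not
change any lower Lebesgue integral: `∫⁻ F(V[e ↦ V(e) g]) dμ = ∫⁻ F dμ`. -/
theorem coareaWegner_lintegral_pi_update_mul (e : ι) (g : G) (F : (ι → G) → ℝ≥0∞) :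
    ∫⁻ V, F (Function.update V e (V e * g)) ∂(Measure.pi fun _ : ι => haarProbability G) =
      ∫⁻ V, F V ∂(Measure.pi fun _ : ι => haarProbability G) := by
  simp_rw [coareaWegner_update_mul_eq]
  exact lintegral_mul_right_eq_self F _

/-- The measure of a set is likewise unchanged (take `F` an indicator): the configurations that are
moved into `s` by `V ↦ V[e ↦ V(e) g]` have the same product-Haar measure as `s`. -/
theorem coareaWegner_measure_preimage_update_mul (e : ι) (g : G) (s : Set (ι → G)) :
    (Measure.pi fun _ : ι => haarProbability G) ((fun V => Function.update V e (V e * g)) ⁻¹' s) =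
      (Measure.pi fun _ : ι => haarProbability G) s := by
  have h : (fun V : ι → G => Function.update V e (V e * g)) =
      fun V => V * Function.update (1 : ι → G) e g := by
    funext V
    exact coareaWegner_update_mul_eq V e g
  rw [h]
  exact measure_preimage_mul_right _ _ _

variable [SecondCountableTopology G]

omit [CompactSpace G] [Fintype ι] in
/-- Joint measurability of the slicing map `(V, t) ↦ V[e ↦ V(e) c(t)]` (for a measurable curve `c`;
`G` second countable, as is every closed subgroup of `U(N)`). -/
theorem coareaWegner_measurable_update_mul_curve (e : ι) {c : ℝ → G} (hc : Measurable c) :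
    Measurable (fun p : (ι → G) × ℝ => Function.update p.1 e (p.1 e * c p.2)) := by
  have h1 : Measurable (fun p : (ι → G) × ℝ => (p.1, p.1 e * c p.2)) :=
    measurable_fst.prodMk (((measurable_pi_apply e).comp measurable_fst).mul (hc.comp measurable_snd))
  exact measurable_update'.comp h1

/-- **Slice lemma, averaged form.**  For measurable `F ≥ 0`, a measurable curve `c : ℝ → G`, a link
`e` and `T > 0`:
`∫⁻ F dμ = T⁻¹ · ∫⁻_V ( ∫⁻_{t ∈ (0, T]} F(V[e ↦ V(e) c(t)]) dt ) dμ`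
(slice lemma for each `t`, average of the constant over `t ∈ (0, T]`, Tonelli). -/
theorem coareaWegner_lintegral_pi_eq_average (e : ι) {c : ℝ → G} (hc : Measurable c)
    {F : (ι → G) → ℝ≥0∞} (hF : Measurable F) {T : ℝ} (hT : 0 < T) :
    ∫⁻ V, F V ∂(Measure.pi fun _ : ι => haarProbability G) =
      ENNReal.ofReal T⁻¹ *
        ∫⁻ V, (∫⁻ t in Set.Ioc 0 T, F (Function.update V e (V e * c t)))
          ∂(Measure.pi fun _ : ι => haarProbability G) := by
  set μ : Measure (ι → G) := Measure.pi fun _ : ι => haarProbability G with hμ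
  have hmeas : AEMeasurable
      (Function.uncurry fun (V : ι → G) (t : ℝ) => F (Function.update V e (V e * c t)))
      (μ.prod (volume.restrict (Set.Ioc 0 T))) :=
    (hF.comp (coareaWegner_measurable_update_mul_curve e hc)).aemeasurable
  rw [lintegral_lintegral_swap hmeas]
  have hinner : ∀ t : ℝ, ∫⁻ V, F (Function.update V e (V e * c t)) ∂μ = ∫⁻ V, F V ∂μ :=
    fun t => coareaWegner_lintegral_pi_update_mul e (c t) F
  simp_rw [hinner]
  rw [setLIntegral_const, Real.volume_Ioc, sub_zero, ← mul_assoc, mul_comm (ENNReal.ofReal T⁻¹),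
    mul_assoc, ← ENNReal.ofReal_mul (inv_nonneg.2 hT.le), inv_mul_cancel₀ hT.ne', ENNReal.ofReal_one,
    mul_one]

/-- **Slice lemma along a closed circle (`T = 2π`).**  For measurable `F ≥ 0`, a measurable curve
`c : ℝ → G` (e.g. one of the eight `2π`-periodic `SU(3)` basis circles of `coareaWegner_su3Circles`)
and a link `e`:
`∫⁻ F dμ = (2π)⁻¹ · ∫⁻_V ( ∫⁻_{t ∈ (0, 2π]} F(V[e ↦ V(e) c(t)]) dt ) dμ`. -/
theorem coareaWegner_lintegral_pi_eq_circleAverage (e : ι) {c : ℝ → G} (hc : Measurable c)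
    {F : (ι → G) → ℝ≥0∞} (hF : Measurable F) :
    ∫⁻ V, F V ∂(Measure.pi fun _ : ι => haarProbability G) =
      ENNReal.ofReal (2 * Real.pi)⁻¹ *
        ∫⁻ V, (∫⁻ t in Set.Ioc 0 (2 * Real.pi), F (Function.update V e (V e * c t)))
          ∂(Measure.pi fun _ : ι => haarProbability G) :=
  coareaWegner_lintegral_pi_eq_average e hc hF Real.two_pi_pos

/-- **Slice inequality with a circle-constant weight.**  If a measurable weight `M ≥ 0` is constant
along the `e`-fibres (`M(V[e ↦ V(e) g]) = M(V)`, e.g. `M = (min_g bad(V[e ↦ g]))^{-k}`) and the circle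
integrals of a measurable `S ≥ 0` are uniformly bounded, `∫⁻_{(0,2π]} S(V[e ↦ V(e)c(t)]) dt ≤ B` for
all `V`, then `∫⁻ M · S dμ ≤ (2π)⁻¹ · B · ∫⁻ M dμ`. -/
theorem coareaWegner_lintegral_mul_le_of_circle_bound (e : ι) {c : ℝ → G} (hc : Measurable c)
    {M S : (ι → G) → ℝ≥0∞} (hM : Measurable M) (hS : Measurable S)
    (hMe : ∀ (V : ι → G) (g : G), M (Function.update V e (V e * g)) = M V) {B : ℝ≥0∞}
    (hB : ∀ V : ι → G, ∫⁻ t in Set.Ioc 0 (2 * Real.pi), S (Function.update V e (V e * c t)) ≤ B) :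
    ∫⁻ V, M V * S V ∂(Measure.pi fun _ : ι => haarProbability G) ≤
      ENNReal.ofReal (2 * Real.pi)⁻¹ * B * ∫⁻ V, M V ∂(Measure.pi fun _ : ι => haarProbability G) := by
  set μ : Measure (ι → G) := Measure.pi fun _ : ι => haarProbability G with hμ
  have hcurve : ∀ V : ι → G, Measurable fun t : ℝ => S (Function.update V e (V e * c t)) := fun V =>
    hS.comp ((coareaWegner_measurable_update_mul_curve e hc).comp (measurable_const.prodMk measurable_id))
  have hMS : Measurable fun V : ι → G => M V * S V := hM.mul hS
  rw [coareaWegner_lintegral_pi_eq_circleAverage e hc hMS, mul_assoc]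
  refine mul_le_mul' le_rfl ?_
  calc ∫⁻ V, (∫⁻ t in Set.Ioc 0 (2 * Real.pi),
          M (Function.update V e (V e * c t)) * S (Function.update V e (V e * c t))) ∂μ
      = ∫⁻ V, M V * (∫⁻ t in Set.Ioc 0 (2 * Real.pi), S (Function.update V e (V e * c t))) ∂μ := by
        refine lintegral_congr fun V => ?_
        simp_rw [hMe]
        exact lintegral_const_mul _ (hcurve V)
    _ ≤ ∫⁻ V, M V * B ∂μ := lintegral_mono fun V => mul_le_mul' le_rfl (hB V)
    _ = (∫⁻ V, M V ∂μ) * B := lintegral_mul_const B hM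
    _ = B * ∫⁻ V, M V ∂μ := mul_comm _ _

end Slice

/-- **Slice lemma for the cell configurations of the registered signature** (`G = SU(3)`,
`ι = Edge 4 L`): for measurable `F ≥ 0` on gauge fields, a measurable curve `c : ℝ → SU(3)` and a
link `e`, `∫⁻ F dμ = (2π)⁻¹ ∫⁻_V ∫⁻_{t ∈ (0,2π]} F(V[e ↦ V(e) c(t)]) dt dμ` for the product Haar
measure `μ = Measure.pi fun _ => haarProbability SU3`. -/
theorem coareaWegner_lintegral_gauge_eq_circleAverage {L : ℕ} [NeZero L] (e : Edge 4 L) {c : ℝ → SU3}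
    (hc : Measurable c) {F : GaugeConfig 4 L SU3 → ENNReal} (hF : Measurable F) :
    ∫⁻ V, F V ∂(Measure.pi fun _ : Edge 4 L => haarProbability SU3) =
      ENNReal.ofReal (2 * Real.pi)⁻¹ *
        ∫⁻ V, (∫⁻ t in Set.Ioc 0 (2 * Real.pi), F (Function.update V e (V e * c t)))
          ∂(Measure.pi fun _ : Edge 4 L => haarProbability SU3) :=
  coareaWegner_lintegral_pi_eq_circleAverage e hc hF

end Summit.QuantumFields.QCD.Cruxes.WegnerEstimate.ResolventCell

end
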